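import Summits.BirchSwinnertonDyer.BirchSwinnertonDyer.Theorems.ErratumRoadFiveEulerHalfNotRamInertUpToOne
import Summits.BirchSwinnertonDyer.BirchSwinnertonDyer.Theorems.ErratumRoadFiveEulerHalfNotRamInert
import Summits.BirchSwinnertonDyer.Rank1Residual.X11b.BDPRouteTamagawaSupport
import Literature.NumberTheory.EllipticCurves.QuadraticTwistLocalDataAtTwoHoldsProofs
import HarnessLib

/-!
# Route `ErratumRoadFive` (K2, `p ≥ 5`), crux `EulerHalfNotRamNoInertSetAtFive` (item stmt-BirchSwinnertonDyer-19715), line `birth`: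
# THE SHARP UP-TO-ONE ROAD (B♯) AND THE EXHAUSTION LEMMA — outside the inert-set datum (A) and the sharp up-to-one datum (B♯)
# EVERY multiplicative prime of `E`, the BSD prime `p` included, is a `p`-carrier (`p ∣ ord_ℓ Δ_min`)
# (cell `bsd-stepL`, lead seat `bsd-line-er5-p1` g1; `--supports stmt-BirchSwinnertonDyer-19715 --as helper`)

WHAT. Two bookkeeping facts of the line `birth` (skeleton v9 → v10), adapted from the ideator's kernel-checked crux workfile
`Cruxes/EulerHalfNotRamNoInertSetAtFive/Lines/level_lowering_cut.lean` §0–§2 (bsd-idea-9 g3, 2026-08-28; = `Lines/coker_units_surj.lean` §1–§2), which is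
not importable from `Theorems/`, restated WITHOUT definitions (every datum spelled out verbatim in the currency of the route decl
`Theses.ErratumRoadFive.EulerHalfNotRamNoInertSetAtFive`):

* §1 `missingUpperBoundAt_of_classX11b_of_not_ram_of_upToOneSharp_of_savedDisplayD` ∕ `res_upToOneSharpAtFive_of_savedDisplayD_of_lowerX11a` — the
  UP-TO-ONE inert road of p616118 (`EulerHalfInertUpToOne.missingUpperBoundAt_of_classX11b_of_not_ram_of_upToOne_of_savedDisplayD`) with its degree datum
  WIDENED from the Papikian–Rabinoff half alone to corner-p1's full «(W) witness ∨ (P) half» (the `hdegDatum` binder of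
  `Theorems.missingUpperBoundAt_of_classX11b_of_inertSet_of_extraPlace_odd_of_twinLowerD` takes it verbatim): the (B♯) road. Same inputs as the v9 road —
  printed facts, the crux `X11aLowerHalf` as a hypothesis, Barrios' `c₂` fact, and the cell's typed object `Theorems.ShimuraInertSavedDisplayAtD` (HOLE 1).
* §2 `allCarriers_of_not_inertSetDatum_of_not_upToOneSharpDatum` — THE EXHAUSTION LEMMA (finite bookkeeping, no arithmetic input): `p ≥ 5` multiplicative,
  a second multiplicative prime, NO inert-set datum (A) (the clause negated in the crux) and NO (B♯) datum ⟹ every multiplicative `ℓ₁` (in particular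
  `ℓ₁ = p`) has `p ∣ ord_{ℓ₁} Δ_min`. So the residual of the line after the (A) and (B♯) roads is the ALL-CARRIERS locus: `E[p]` is finite at `p` and
  unramified at every multiplicative prime — the input of the level-lowering cut (`ErratumRoadFiveEulerHalfNotRamLevelLoweringCut.lean`).

HONEST FRAMING: THEOREMS ONLY, CONDITIONAL on their displayed hypotheses; no `sorry`, no definition, no new named fact; nothing booked; item 19715 is NOT
closed; BSD is proved for no curve; no summit statement is touched. Credit: statements and proofs are the ideator's (bsd-idea-9 g3), moved to `Theorems/`
by the lead so that the v10 skeleton can cite them by name.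
References (locators only): [cite: Jetchev2008, Cor. 1.5 (p. 812)] [cite: PastenShimura2024, §6.6, Lemma 6.18] [cite: PapikianRabinoff2016, Cor. 3.5].
-/

set_option autoImplicit false
set_option linter.dupNamespace false

noncomputable section

open scoped Classical

open WeierstrassCurve Literature.NumberTheory.EllipticCurves Literature.NumberTheory.EllipticCurves.BarriosEtAl2025
  Literature.NumberTheory.EllipticCurves.ModularForms Literature.NumberTheory.EllipticCurves.Rank1Residual
  Literature.NumberTheory.EllipticCurves.Rank1Residual.Typed Literature.NumberTheory.Automorphic
  Summit.BirchSwinnertonDyer.Rank1Residual Summit.BirchSwinnertonDyer.Rank1Residual.X11b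

namespace Summit.BirchSwinnertonDyer.BirchSwinnertonDyer.Theorems.EulerHalfExhaustion

/-! ### §1 The (B♯) road: the up-to-one inert road with the full «(W) witness ∨ (P) half» degree datum -/

/-- **Pair level, (B♯).** For an X11b pair `(E, p)`, `p ≥ 5`, no (ram) prime, a split multiplicative `q₁` carrying the SAVED inert display
`Theorems.ShimuraInertSavedDisplayAtD W p q₁`, and an even multiplicative set `S ∋ p`, `q₁ ∉ S`, containing every offending split carrier `≠ q₁`, with
degree datum «a multiplicative NON-carrier `ℓ₁` (inside `S`, or outside `S` together with a second outside multiplicative prime) ∨ a Papikian–Rabinoff half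
`R ⊆ S`»: `Typed.MissingUpperBoundAt W p`. This is p616118's up-to-one road with the degree datum widened to the core's own binder; CONDITIONAL on the
printed inputs, `X11aLowerHalf` (as `hX11a`) and the typed saved display. [cite: Jetchev2008, Cor. 1.5] [cite: PastenShimura2024, §6.6, Lemma 6.18] -/
theorem missingUpperBoundAt_of_classX11b_of_not_ram_of_upToOneSharp_of_savedDisplayD
    (hGZK : rank_eq_analyticRank_of_analyticRank_le_one) (hmod : hasEntireLFunction_rat)
    (hnf : exists_isNewformOf) (hFH : friedbergHoffstein_exists_twist_ne_zero_inertAt)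
    (hMaz : mazur_not_dvd_maninConstant_of_odd)
    (hBR : localTamagawaNumber_quadraticTwist_two_mem_of_goodReduction)
    (hJL : nonempty_shimuraParametrizationData)
    (hCO : PastenShimura2024_componentOrders)
    (W : WeierstrassCurve ℚ) [W.IsElliptic] [W.IsGloballyMinimal] (p : ℕ) [Fact p.Prime]
    (hX : ClassX11b W p) (hp5 : 5 ≤ p) (hnram : ¬ Ram W p)
    (hX11a : ∀ (Wd : WeierstrassCurve ℚ) [Wd.IsElliptic] [Wd.IsGloballyMinimal],
      ClassX11a Wd p → Typed.MissingLowerBoundAt Wd p)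
    (q₁ : ℕ) [Fact q₁.Prime] (hq₁ : W.HasSplitMultiplicativeReductionAtPrime q₁)
    (hSavD : Theorems.ShimuraInertSavedDisplayAtD W p q₁)
    (hdat : ∃ S : Finset ℕ, (∀ ℓ ∈ S, ∃ _ : Fact ℓ.Prime, Mult W ℓ) ∧ Even S.card ∧ p ∈ S ∧ q₁ ∉ S ∧
      (∀ (ℓ : ℕ) [Fact ℓ.Prime], ℓ ∉ S → ℓ ≠ q₁ → W.HasSplitMultiplicativeReductionAtPrime ℓ →
        ¬ p ∣ padicValInt ℓ W.minimalDiscriminantInt) ∧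
      ((∃ (ℓ₁ : ℕ) (_ : Fact ℓ₁.Prime), Mult W ℓ₁ ∧ ¬ p ∣ padicValInt ℓ₁ W.minimalDiscriminantInt ∧
          (ℓ₁ ∈ S ∨ ∃ (t : ℕ) (_ : Fact t.Prime), Mult W t ∧ t ∉ S ∧ t ≠ ℓ₁)) ∨
        ∃ R ⊆ S, S.card = 2 * R.card ∧ ∀ q ∈ R, q ≠ 2 ∧ ¬ p ∣ q - 1)) :
    Typed.MissingUpperBoundAt W p := by
  obtain ⟨S, hSmult, hSeven, hpS, hq₁S, hFC, hdeg⟩ := hdat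
  have hbad₁ : ¬ W.HasGoodReductionAtPrime q₁ :=
    WeierstrassCurve.HasMultiplicativeReduction.not_hasGoodReduction (R := ℤ_[q₁]) hq₁.hasMultiplicativeReductionAtPrime
  have hshape : ∀ (q : ℕ) [Fact q.Prime], q ≠ q₁ → p ∣ (W.baseChange ℚ_[q]).localTamagawaNumber ℤ_[q] →
      W.HasSplitMultiplicativeReductionAtPrime q := by
    intro q _ _ hdvd
    haveI : (W.baseChange ℚ_[q]).IsElliptic := inferInstanceAs (W.map (algebraMap ℚ ℚ_[q])).IsElliptic
    exact hasSplitMultiplicativeReduction_of_five_le_of_dvd_localTamagawaNumber q (W.baseChange ℚ_[q]) hp5 hdvd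
  exact Theorems.missingUpperBoundAt_of_classX11b_of_inertSet_of_extraPlace_odd_of_twinLowerD hGZK hmod hnf hMaz hBR hJL hCO W p
    hX q₁ hbad₁ hshape hSavD (Theorems.fhTwinLowerSupplyAt_of_friedbergHoffstein_of_x11aLowerHalf hGZK hmod hnf hFH W p hX hnram hX11a)
    S hSmult hSeven hpS hq₁S (fun ℓ _ hℓS hℓq hs ↦ hFC ℓ hℓS hℓq hs) hdeg

/-- **Class level, (B♯).** Every X11b ∧ `p ≥ 5` ∧ surj ∧ ¬(ram) pair carrying a SHARP up-to-one datum (an offending split carrier `q₁`, an even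
multiplicative `S ∋ p`, `q₁ ∉ S`, containing every other offending split carrier, and the degree datum «(W) non-carrier witness ∨ (P) half») has
`Typed.MissingUpperBoundAt W p`, GIVEN the printed inputs, `X11aLowerHalf` (as `hX11a`) and the saved inert display at offending carriers in the ∀-form of
the line's typed stub `stub_shimuraInertSavedDisplayAtFive` (HOLE 1). [cite: Jetchev2008, Cor. 1.5] [cite: PastenShimura2024, §6.6] -/
theorem res_upToOneSharpAtFive_of_savedDisplayD_of_lowerX11a
    (hGZK : rank_eq_analyticRank_of_analyticRank_le_one) (hmod : hasEntireLFunction_rat)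
    (hnf : exists_isNewformOf) (hFH : friedbergHoffstein_exists_twist_ne_zero_inertAt)
    (hMaz : mazur_not_dvd_maninConstant_of_odd)
    (hBR : localTamagawaNumber_quadraticTwist_two_mem_of_goodReduction)
    (hJL : nonempty_shimuraParametrizationData)
    (hCO : PastenShimura2024_componentOrders)
    (hX11a : ∀ (Wd : WeierstrassCurve ℚ) [Wd.IsElliptic] [Wd.IsGloballyMinimal] (p : ℕ) [Fact p.Prime],
      ClassX11a Wd p → Typed.MissingLowerBoundAt Wd p)
    (hSavD : ∀ (W : WeierstrassCurve ℚ) [W.IsElliptic] [W.IsGloballyMinimal] (p : ℕ) [Fact p.Prime]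
      (q₁ : ℕ) [Fact q₁.Prime], ClassX11b W p → 5 ≤ p → Surj W p → ¬ Ram W p →
      W.HasSplitMultiplicativeReductionAtPrime q₁ → p ∣ padicValInt q₁ W.minimalDiscriminantInt →
      Theorems.ShimuraInertSavedDisplayAtD W p q₁) :
    ∀ (W : WeierstrassCurve ℚ) [W.IsElliptic] [W.IsGloballyMinimal] (p : ℕ) [Fact p.Prime],
      ClassX11b W p → 5 ≤ p → Surj W p → ¬ Ram W p →
      (∃ (q₁ : ℕ) (_ : Fact q₁.Prime) (S : Finset ℕ), W.HasSplitMultiplicativeReductionAtPrime q₁ ∧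
        p ∣ padicValInt q₁ W.minimalDiscriminantInt ∧
        (∀ ℓ ∈ S, ∃ _ : Fact ℓ.Prime, Mult W ℓ) ∧ Even S.card ∧ p ∈ S ∧ q₁ ∉ S ∧
        (∀ (ℓ : ℕ) [Fact ℓ.Prime], ℓ ∉ S → ℓ ≠ q₁ → W.HasSplitMultiplicativeReductionAtPrime ℓ →
          ¬ p ∣ padicValInt ℓ W.minimalDiscriminantInt) ∧
        ((∃ (ℓ₁ : ℕ) (_ : Fact ℓ₁.Prime), Mult W ℓ₁ ∧ ¬ p ∣ padicValInt ℓ₁ W.minimalDiscriminantInt ∧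
            (ℓ₁ ∈ S ∨ ∃ (t : ℕ) (_ : Fact t.Prime), Mult W t ∧ t ∉ S ∧ t ≠ ℓ₁)) ∨
          ∃ R ⊆ S, S.card = 2 * R.card ∧ ∀ q ∈ R, q ≠ 2 ∧ ¬ p ∣ q - 1)) →
      Typed.MissingUpperBoundAt W p := by
  intro W _ _ p _ hX hp5 hsurj hnram hdat
  obtain ⟨q₁, _, S, hq₁, hoff, hSmult, hSeven, hpS, hq₁S, hFC, hdeg⟩ := hdat
  exact missingUpperBoundAt_of_classX11b_of_not_ram_of_upToOneSharp_of_savedDisplayD hGZK hmod hnf hFH hMaz hBR hJL hCO W p hX hp5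
    hnram (fun Wd _ _ hXa ↦ hX11a Wd p hXa) q₁ hq₁ (hSavD W p q₁ hX hp5 hsurj hnram hq₁ hoff)
    ⟨S, hSmult, hSeven, hpS, hq₁S, hFC, hdeg⟩

/-! ### §2 The exhaustion lemma: outside (A) ∪ (B♯) every multiplicative prime is a `p`-carrier -/

/-- **Exhaustion.** `W` globally minimal, `p ≥ 5` multiplicative, some multiplicative `ℓ ≠ p`, NO inert-set datum (A) (an even multiplicative `S ∋ p`
containing every offending split carrier, with «`p ∤ ord_p Δ_min` ∨ a Papikian–Rabinoff half») and NO sharp up-to-one datum (B♯) ⟹ every multiplicative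
prime `ℓ₁` of `W` has `p ∣ ord_{ℓ₁}(Δ_min)`. Proof (`O` = the offending split carriers, a finite set since they divide the conductor): if `O ⊆ {p}`,
`S = {p, x}`, `R = {p}` is an (A) datum (`p ≠ 2`, `p ∤ p − 1`); else pick `q₁ ∈ O ∖ {p}` and `S₀ = {p} ∪ (O ∖ {q₁})`; a non-carrier `ℓ₁` gives the (B♯)
datum `S₀` (even case) or `S₀ ∪ {ℓ₁}` (odd case, `ℓ₁ ≠ p`) with witness `ℓ₁` and second outside prime `t = q₁`, or the (A) datum `S₀ ∪ {q₁}` with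
`p ∤ ord_p Δ` (odd case, `ℓ₁ = p`). Finite bookkeeping only. [cite: PastenShimura2024, §6.6 (admissible factorisations N = DM, D of even cardinality)] -/
theorem allCarriers_of_not_inertSetDatum_of_not_upToOneSharpDatum
    (W : WeierstrassCurve ℚ) [W.IsElliptic] [W.IsGloballyMinimal] (p : ℕ) [Fact p.Prime]
    (hp5 : 5 ≤ p) (hMp : Mult W p)
    (hother : ∃ ℓ : ℕ, ∃ _ : Fact ℓ.Prime, ℓ ≠ p ∧ W.HasMultiplicativeReductionAtPrime ℓ)
    (hnoP : ¬ ∃ S : Finset ℕ, (∀ ℓ ∈ S, ∃ _ : Fact ℓ.Prime, Mult W ℓ) ∧ Even S.card ∧ p ∈ S ∧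
      (∀ (ℓ : ℕ) [Fact ℓ.Prime], ℓ ∉ S → W.HasSplitMultiplicativeReductionAtPrime ℓ → ¬ p ∣ padicValInt ℓ W.minimalDiscriminantInt) ∧
      (¬ p ∣ padicValInt p W.minimalDiscriminantInt ∨ ∃ R ⊆ S, S.card = 2 * R.card ∧ ∀ q ∈ R, q ≠ 2 ∧ ¬ p ∣ q - 1))
    (hnoB : ¬ ∃ (q₁ : ℕ) (_ : Fact q₁.Prime) (S : Finset ℕ), W.HasSplitMultiplicativeReductionAtPrime q₁ ∧
      p ∣ padicValInt q₁ W.minimalDiscriminantInt ∧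
      (∀ ℓ ∈ S, ∃ _ : Fact ℓ.Prime, Mult W ℓ) ∧ Even S.card ∧ p ∈ S ∧ q₁ ∉ S ∧
      (∀ (ℓ : ℕ) [Fact ℓ.Prime], ℓ ∉ S → ℓ ≠ q₁ → W.HasSplitMultiplicativeReductionAtPrime ℓ →
        ¬ p ∣ padicValInt ℓ W.minimalDiscriminantInt) ∧
      ((∃ (ℓ₁ : ℕ) (_ : Fact ℓ₁.Prime), Mult W ℓ₁ ∧ ¬ p ∣ padicValInt ℓ₁ W.minimalDiscriminantInt ∧
          (ℓ₁ ∈ S ∨ ∃ (t : ℕ) (_ : Fact t.Prime), Mult W t ∧ t ∉ S ∧ t ≠ ℓ₁)) ∨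
        ∃ R ⊆ S, S.card = 2 * R.card ∧ ∀ q ∈ R, q ≠ 2 ∧ ¬ p ∣ q - 1)) :
    ∀ (ℓ₁ : ℕ) [Fact ℓ₁.Prime], Mult W ℓ₁ → p ∣ padicValInt ℓ₁ W.minimalDiscriminantInt := by
  intro ℓ₁ _ hℓ₁
  by_contra hnc
  have hp : p.Prime := Fact.out
  have hN0 : W.conductorNorm ℤ ≠ 0 := (W.conductorNorm_pos_holds).ne'
  have hp2 : p ≠ 2 := by omega
  have hpp1 : ¬ p ∣ p - 1 := Nat.not_dvd_of_pos_of_lt (by omega) (by omega)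
  -- the finite set `O` of offending split carriers
  obtain ⟨O, hOin, hOmem⟩ : ∃ O : Finset ℕ,
      (∀ ℓ ∈ O, ∃ _ : Fact ℓ.Prime, W.HasSplitMultiplicativeReductionAtPrime ℓ ∧ p ∣ padicValInt ℓ W.minimalDiscriminantInt) ∧
      (∀ (ℓ : ℕ) [Fact ℓ.Prime], W.HasSplitMultiplicativeReductionAtPrime ℓ → p ∣ padicValInt ℓ W.minimalDiscriminantInt → ℓ ∈ O) := by
    refine ⟨(W.conductorNorm ℤ).primeFactors.filter (fun ℓ ↦ ∃ h : ℓ.Prime,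
        @WeierstrassCurve.HasSplitMultiplicativeReductionAtPrime W ℓ ⟨h⟩ ∧ p ∣ padicValInt ℓ W.minimalDiscriminantInt), ?_, ?_⟩
    · intro ℓ hℓ
      obtain ⟨-, hℓP, hs, hc⟩ := Finset.mem_filter.mp hℓ
      exact ⟨⟨hℓP⟩, hs, hc⟩
    · intro ℓ hℓ hs hc
      have hℓN : ℓ ∣ W.conductorNorm ℤ :=
        (W.dvd_conductorNorm_iff_not_hasGoodReductionAtPrime ℓ).mpr
          (WeierstrassCurve.HasMultiplicativeReduction.not_hasGoodReduction (R := ℤ_[ℓ]) hs.hasMultiplicativeReductionAtPrime)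
      exact Finset.mem_filter.mpr ⟨Nat.mem_primeFactors.mpr ⟨hℓ.out, hℓN, hN0⟩, hℓ.out, hs, hc⟩
  have hOmult : ∀ ℓ ∈ O, ∃ _ : Fact ℓ.Prime, Mult W ℓ := fun ℓ hℓ ↦ by
    obtain ⟨i, hs, -⟩ := hOin ℓ hℓ
    exact ⟨i, hs.hasMultiplicativeReductionAtPrime⟩
  -- `ℓ₁` is not offending
  have hℓ₁O : ℓ₁ ∉ O := fun h ↦ by
    obtain ⟨_, -, hc⟩ := hOin ℓ₁ h
    exact hnc hc
  obtain ⟨x, _, hxp, hxm⟩ := hother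
  by_cases hO : ∀ q ∈ O, q = p
  · -- Case O ⊆ {p}: the (A) datum S = {p, x}, R = {p}
    refine hnoP ⟨{p, x}, ?_, ?_, by simp, ?_, Or.inr ⟨{p}, by simp, ?_, ?_⟩⟩
    · intro ℓ hℓ
      rcases Finset.mem_insert.mp hℓ with rfl | hℓ
      · exact ⟨‹_›, hMp⟩
      · rw [Finset.mem_singleton] at hℓ
        subst hℓ
        exact ⟨‹_›, hxm⟩
    · rw [Finset.card_pair (Ne.symm hxp)]
      exact even_two
    · intro ℓ _ hℓS hs hc
      have := hO ℓ (hOmem ℓ hs hc)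
      subst this
      simp at hℓS
    · rw [Finset.card_pair (Ne.symm hxp), Finset.card_singleton]
    · intro q hq
      rw [Finset.mem_singleton] at hq
      subst hq
      exact ⟨hp2, hpp1⟩
  · -- Case ∃ q₁ ∈ O, q₁ ≠ p
    push Not at hO
    obtain ⟨q₁, hq₁O, hq₁p⟩ := hO
    obtain ⟨iq₁, hq₁s, hq₁c⟩ := hOin q₁ hq₁O
    have hq₁ℓ₁ : q₁ ≠ ℓ₁ := fun h ↦ hℓ₁O (h ▸ hq₁O)
    set S₀ : Finset ℕ := insert p (O.erase q₁) with hS₀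
    have hS₀mult : ∀ ℓ ∈ S₀, ∃ _ : Fact ℓ.Prime, Mult W ℓ := by
      intro ℓ hℓ
      rcases Finset.mem_insert.mp hℓ with rfl | hℓ
      · exact ⟨‹_›, hMp⟩
      · exact hOmult ℓ (Finset.mem_of_mem_erase hℓ)
    have hpS₀ : p ∈ S₀ := Finset.mem_insert_self _ _
    have hq₁S₀ : q₁ ∉ S₀ := by
      intro h
      rcases Finset.mem_insert.mp h with h | h
      · exact hq₁p h
      · exact (Finset.notMem_erase q₁ O) h
    have hℓ₁S₀ : ℓ₁ ∈ S₀ → ℓ₁ = p := by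
      intro h
      rcases Finset.mem_insert.mp h with h | h
      · exact h
      · exact absurd (Finset.mem_of_mem_erase h) hℓ₁O
    -- every offending split carrier other than q₁ lies in S₀
    have hFC₀ : ∀ (ℓ : ℕ) [Fact ℓ.Prime], ℓ ∉ S₀ → ℓ ≠ q₁ → W.HasSplitMultiplicativeReductionAtPrime ℓ →
        ¬ p ∣ padicValInt ℓ W.minimalDiscriminantInt := by
      intro ℓ _ hℓS hℓq hs hc
      exact hℓS (Finset.mem_insert_of_mem (Finset.mem_erase.mpr ⟨hℓq, hOmem ℓ hs hc⟩))
    rcases Nat.even_or_odd S₀.card with he | ho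
    · -- even: (B♯) with S = S₀, witness ℓ₁ outside S with second outside prime t = q₁ (or inside if ℓ₁ = p)
      refine hnoB ⟨q₁, iq₁, S₀, hq₁s, hq₁c, hS₀mult, he, hpS₀, hq₁S₀, hFC₀, Or.inl ⟨ℓ₁, ‹_›, hℓ₁, hnc, ?_⟩⟩
      by_cases h : ℓ₁ ∈ S₀
      · exact Or.inl h
      · exact Or.inr ⟨q₁, iq₁, hq₁s.hasMultiplicativeReductionAtPrime, hq₁S₀, hq₁ℓ₁⟩
    · by_cases hℓp : ℓ₁ = p
      · -- odd, ℓ₁ = p: the (A) datum S = S₀ ∪ {q₁} with p ∤ ord_p Δ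
        subst hℓp
        refine hnoP ⟨insert q₁ S₀, ?_, ?_, Finset.mem_insert_of_mem hpS₀, ?_, Or.inl hnc⟩
        · intro ℓ hℓ
          rcases Finset.mem_insert.mp hℓ with rfl | hℓ
          · exact ⟨iq₁, hq₁s.hasMultiplicativeReductionAtPrime⟩
          · exact hS₀mult ℓ hℓ
        · rw [Finset.card_insert_of_notMem hq₁S₀]
          exact ho.add_one
        · intro ℓ _ hℓS hs hc
          have hℓq : ℓ ≠ q₁ := fun h ↦ hℓS (h ▸ Finset.mem_insert_self q₁ S₀)
          exact hFC₀ ℓ (fun h ↦ hℓS (Finset.mem_insert_of_mem h)) hℓq hs hc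
      · -- odd, ℓ₁ ≠ p: (B♯) with S = S₀ ∪ {ℓ₁}, witness ℓ₁ ∈ S
        have hℓ₁S₀' : ℓ₁ ∉ S₀ := fun h ↦ hℓp (hℓ₁S₀ h)
        refine hnoB ⟨q₁, iq₁, insert ℓ₁ S₀, hq₁s, hq₁c, ?_, ?_, Finset.mem_insert_of_mem hpS₀, ?_, ?_,
          Or.inl ⟨ℓ₁, ‹_›, hℓ₁, hnc, Or.inl (Finset.mem_insert_self _ _)⟩⟩
        · intro ℓ hℓ
          rcases Finset.mem_insert.mp hℓ with rfl | hℓ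
          · exact ⟨‹_›, hℓ₁⟩
          · exact hS₀mult ℓ hℓ
        · rw [Finset.card_insert_of_notMem hℓ₁S₀']
          exact ho.add_one
        · intro h
          rcases Finset.mem_insert.mp h with h | h
          · exact hq₁ℓ₁ h
          · exact hq₁S₀ h
        · intro ℓ _ hℓS hℓq hs hc
          exact hFC₀ ℓ (fun h ↦ hℓS (Finset.mem_insert_of_mem h)) hℓq hs hc

/-- **Corollary (the all-carriers locus pins `p`).** Under the hypotheses of the exhaustion lemma the BSD prime itself is a `p`-carrier:
`p ∣ ord_p(Δ_min)` — `E[p]` is finite (peu ramifié) at `p`. [cite: PastenShimura2024, §6.6] -/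
theorem dvd_ordp_of_not_inertSetDatum_of_not_upToOneSharpDatum
    (W : WeierstrassCurve ℚ) [W.IsElliptic] [W.IsGloballyMinimal] (p : ℕ) [Fact p.Prime]
    (hp5 : 5 ≤ p) (hMp : Mult W p)
    (hother : ∃ ℓ : ℕ, ∃ _ : Fact ℓ.Prime, ℓ ≠ p ∧ W.HasMultiplicativeReductionAtPrime ℓ)
    (hnoP : ¬ ∃ S : Finset ℕ, (∀ ℓ ∈ S, ∃ _ : Fact ℓ.Prime, Mult W ℓ) ∧ Even S.card ∧ p ∈ S ∧
      (∀ (ℓ : ℕ) [Fact ℓ.Prime], ℓ ∉ S → W.HasSplitMultiplicativeReductionAtPrime ℓ → ¬ p ∣ padicValInt ℓ W.minimalDiscriminantInt) ∧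
      (¬ p ∣ padicValInt p W.minimalDiscriminantInt ∨ ∃ R ⊆ S, S.card = 2 * R.card ∧ ∀ q ∈ R, q ≠ 2 ∧ ¬ p ∣ q - 1))
    (hnoB : ¬ ∃ (q₁ : ℕ) (_ : Fact q₁.Prime) (S : Finset ℕ), W.HasSplitMultiplicativeReductionAtPrime q₁ ∧
      p ∣ padicValInt q₁ W.minimalDiscriminantInt ∧
      (∀ ℓ ∈ S, ∃ _ : Fact ℓ.Prime, Mult W ℓ) ∧ Even S.card ∧ p ∈ S ∧ q₁ ∉ S ∧
      (∀ (ℓ : ℕ) [Fact ℓ.Prime], ℓ ∉ S → ℓ ≠ q₁ → W.HasSplitMultiplicativeReductionAtPrime ℓ →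
        ¬ p ∣ padicValInt ℓ W.minimalDiscriminantInt) ∧
      ((∃ (ℓ₁ : ℕ) (_ : Fact ℓ₁.Prime), Mult W ℓ₁ ∧ ¬ p ∣ padicValInt ℓ₁ W.minimalDiscriminantInt ∧
          (ℓ₁ ∈ S ∨ ∃ (t : ℕ) (_ : Fact t.Prime), Mult W t ∧ t ∉ S ∧ t ≠ ℓ₁)) ∨
        ∃ R ⊆ S, S.card = 2 * R.card ∧ ∀ q ∈ R, q ≠ 2 ∧ ¬ p ∣ q - 1)) :
    p ∣ padicValInt p W.minimalDiscriminantInt :=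
  allCarriers_of_not_inertSetDatum_of_not_upToOneSharpDatum W p hp5 hMp hother hnoP hnoB p hMp

end Summit.BirchSwinnertonDyer.BirchSwinnertonDyer.Theorems.EulerHalfExhaustion

end
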